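import Summits.CriticalPhenomena.PercolationContinuityZ3.Theorems.PercNearOneGluingNoHeavyLowerTailSunflowerChainCertificate
import HarnessLib
import HarnessLib.Audit

/-!
# `NoHeavyLowerTail` (crux stmt-CriticalPhenomena-4575), abstract sunflower cubic: the THREE-BLOCK STRUCTURE LEMMA for rainbows with a
# bottom median (first ingredient of the kernel replay of `ChainCert.ThreeBlockMedianCertificate`)

Support file (seat `prim-ineq-prove-1` gen 33; `--supports stmt-CriticalPhenomena-4575`; companion of `…SunflowerChainCertificate`, p243463).
No `sorry`, no named facts, nothing asserted about the crux.  Memo: run/shared/lean/prim/prim-ineq-prove-1/FINDING-CHAINCERT-prove1-g33.md §2;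
the lemma is g31 memo FINDING-GSATLAS §4c (1), here for arbitrary monotone labellings (coarser than the finest petal structure).

THE LEMMA (`three_block_structure` and its corollaries).  Let `lab` be a monotone labelling of a product of THREE finite chains
(`ChainCert.IsMono`: bottom `0` a down-set, kernel `1` an up-set, comparable petal points in the same petal), and let `u` be a rainbow
(three petal points with pairwise distinct petals) whose coordinatewise median `s = med u` is a bottom point.  Since `u i ≰ s` (else
`u i` would be a bottom point), every point exceeds the median in some block, where it is then the unique maximum; three points and three
blocks force a bijection (`exc u i` = the blocks where `u i` exceeds; `cover_of_three_disjoint`).  Consequences, with `t = join u`: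
* (a) `med_lt_join`: `s e < t e` in EVERY block;
* (b) `lab_lift1`: the one-block lift `s + (t−s)·1_e` (`lift1`) dominates the point exceeding in block `e`, so it is a kernel point or a
  point of THAT petal — never a bottom point, and one-block lifts that are petal points lie in pairwise distinct petals;
* (c) `lab_lift2`: the two-block lift (`lift2`, the join lowered to the median in one block) dominates the two other points, which
  carry distinct petals, so it is a kernel point;
* (d) `lab_join`: the join is a kernel point.
These are exactly the CANDIDATE CONDITIONS under which a pair `(s,t)` of a local box can belong to the median set `Λ_T` (g31 §4c (1)–(2));
they make the antipodal Gladkov count of the box `[s,t]` equal to `1` (only `(t,s)` is a kernel/bottom antipodal pair, no antipodal pair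
lies in two distinct petals), which is why the median rule has multiplicity one for three blocks.  With ≥ 4 blocks the bijection fails
(a point can be the maximum of two blocks) — the source of the multiplicities seen there (g31 §4, g32 §3).

SLOT SYMMETRY (any number `k` of blocks; second ingredient).  The diagonal copy of `S₃` in `S₃^k` permutes the three SLOTS of a triple
(`slotPerm`); orbit sums are invariant under it (`orbitSum_slotPerm`) and additive in the kernel (`orbitSum_add/sub/smul`).  Hence the
kernel `ChainCert.ker` (which orders petals by their index: `lab y < lab z`, `lab x < lab y < lab z`) may be replaced by the SYMMETRIC kernel
`kerSym` (`≠` instead of `<`, multiplicities `6,3,1,6`): `orbitSum_kerSym : orbitSum kerSym = 6 · orbitSum ker`.  `kerSym` sees the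
labelling only through the cells `{lab = 0}`, `{lab = 1}` and the partition of the petal points into petals, which is what a finite
enumeration of local configurations ranges over (no numbering of petals).
-/

namespace Summit.CriticalPhenomena.PercolationContinuityZ3.Theorems.SunflowerPartition

namespace ChainCert

open Finset

/-! ## The three-block structure lemma -/

section StructureLemma

variable {n : Fin 3 → ℕ}

/-- In one block: if a value of the triple exceeds the median then it is the maximum and the two other values are at most the
median. [this work] -/
theorem gt_med_block (a b c x : ℕ) (hx : x = a ∨ x = b ∨ x = c)
    (h : max (min a b) (min (max a b) c) < x) :
    x = max (max a b) c ∧ (x = a → b ≤ max (min a b) (min (max a b) c) ∧ c ≤ max (min a b) (min (max a b) c)) ∧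
      (x = b → a ≤ max (min a b) (min (max a b) c) ∧ c ≤ max (min a b) (min (max a b) c)) ∧
      (x = c → a ≤ max (min a b) (min (max a b) c) ∧ b ≤ max (min a b) (min (max a b) c)) := by
  omega

/-- Three pairwise disjoint nonempty subsets of `Fin 3` cover it, and each is a singleton. [this work] -/
theorem cover_of_three_disjoint (E : Fin 3 → Finset (Fin 3)) (hne : ∀ i, (E i).Nonempty)
    (hdis : ∀ i j, i ≠ j → Disjoint (E i) (E j)) :
    (∀ e, ∃ i, e ∈ E i) ∧ (∀ i e e', e ∈ E i → e' ∈ E i → e = e') := by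
  have hcard : (Finset.univ.biUnion E).card = ∑ i, (E i).card :=
    Finset.card_biUnion (fun i _ j _ hij => hdis i j hij)
  have hle : (Finset.univ.biUnion E).card ≤ 3 := le_trans (Finset.card_le_univ _) (by simp)
  have h1 : ∀ i, 1 ≤ (E i).card := fun i => Finset.card_pos.mpr (hne i)
  have hone : ∀ i, (E i).card = 1 := by
    intro i
    have hsum : ∑ j, (E j).card ≤ 3 := hcard ▸ hle
    have hsplit := Finset.add_sum_erase Finset.univ (fun j => (E j).card) (Finset.mem_univ i)
    have hrest : (Finset.univ.erase i).card ≤ ∑ j ∈ Finset.univ.erase i, (E j).card := by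
      rw [Finset.card_eq_sum_ones]; exact Finset.sum_le_sum fun j _ => h1 j
    have hcard_erase : (Finset.univ.erase i).card = 2 := by
      rw [Finset.card_erase_of_mem (Finset.mem_univ i), Finset.card_univ, Fintype.card_fin]
    have := h1 i
    omega
  refine ⟨?_, ?_⟩
  · intro e
    have huniv : Finset.univ.biUnion E = Finset.univ := by
      apply Finset.eq_univ_of_card
      rw [hcard]; simp [hone]
    have : e ∈ Finset.univ.biUnion E := by rw [huniv]; exact Finset.mem_univ e
    obtain ⟨i, -, hi⟩ := Finset.mem_biUnion.mp this
    exact ⟨i, hi⟩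
  · intro i e e' he he'
    obtain ⟨a, ha⟩ := Finset.card_eq_one.mp (hone i)
    rw [ha, Finset.mem_singleton] at he he'
    rw [he, he']

/-- The exceedance set of point `i` of a triple `u`: the blocks in which `u i` exceeds the median. [this work] -/
def exc (u : Fin 3 → Pt n) (i : Fin 3) : Finset (Fin 3) := Finset.univ.filter fun e => med u e < u i e

/-- A point of a rainbow whose median is a bottom point exceeds the median in some block. [this work] -/
theorem exc_nonempty {lab : Pt n → ℕ} (hlab : IsMono lab) {u : Fin 3 → Pt n} (hu : IsRainbow lab u)
    (hmed : lab (med u) = 0) (i : Fin 3) : (exc u i).Nonempty := by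
  by_contra h
  rw [Finset.not_nonempty_iff_eq_empty, Finset.eq_empty_iff_forall_notMem] at h
  have hle : u i ≤ med u := by
    intro e
    have := h e
    simp only [exc, Finset.mem_filter, Finset.mem_univ, true_and, not_lt] at this
    exact this
  rcases hlab hle with h1 | h1 | h1
  · have := hu.1 i; omega
  · have := hu.1 i; omega
  · omega

/-- In a block where `u i` exceeds the median it equals the join, and the other two points are below the median there. [this work] -/
theorem exc_spec {u : Fin 3 → Pt n} {i : Fin 3} {e : Fin 3} (he : e ∈ exc u i) :
    u i e = join u e ∧ ∀ j, j ≠ i → u j e ≤ med u e := by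
  simp only [exc, Finset.mem_filter, Finset.mem_univ, true_and] at he
  have key := gt_med_block (u 0 e : ℕ) (u 1 e) (u 2 e) (u i e)
    (by fin_cases i <;> simp) (by
      have : ((med u e : Fin (n e)) : ℕ) = max (min (u 0 e : ℕ) (u 1 e)) (min (max (u 0 e : ℕ) (u 1 e)) (u 2 e)) := by
        simp [med, Fin.coe_max, Fin.coe_min]
      rw [← this]; exact_mod_cast he)
  have hmed : ((med u e : Fin (n e)) : ℕ) = max (min (u 0 e : ℕ) (u 1 e)) (min (max (u 0 e : ℕ) (u 1 e)) (u 2 e)) := by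
    simp [med, Fin.coe_max, Fin.coe_min]
  have hjoin : ((join u e : Fin (n e)) : ℕ) = max (max (u 0 e : ℕ) (u 1 e)) (u 2 e) := by
    simp [join, Fin.coe_max]
  obtain ⟨k1, k2, k3, k4⟩ := key
  refine ⟨?_, ?_⟩
  · apply Fin.ext; rw [hjoin]; exact k1
  · intro j hj
    rw [Fin.le_def, hmed]
    fin_cases i <;> fin_cases j <;>
      first
        | exact absurd rfl hj
        | exact (k2 rfl).1 | exact (k2 rfl).2 | exact (k3 rfl).1 | exact (k3 rfl).2 | exact (k4 rfl).1 | exact (k4 rfl).2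

/-- Exceedance sets of distinct points are disjoint. [this work] -/
theorem exc_disjoint (u : Fin 3 → Pt n) {i j : Fin 3} (hij : i ≠ j) : Disjoint (exc u i) (exc u j) := by
  rw [Finset.disjoint_left]
  intro e hei hej
  have h1 := (exc_spec hei).2 j (Ne.symm hij)
  have h2 := exc_spec hej
  simp only [exc, Finset.mem_filter, Finset.mem_univ, true_and] at hej
  exact absurd hej (not_lt.mpr h1)

/-- **Three-block structure lemma.**  For a rainbow `u` in a product of THREE chains whose median is a bottom point: every block `e`
has a (unique) point `i` with `u i e = join u e > med u e`, the other two points being `≤ med u e` in that block; and every point is the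
exceeding point of exactly one block. [this work] -/
theorem three_block_structure {lab : Pt n → ℕ} (hlab : IsMono lab) {u : Fin 3 → Pt n} (hu : IsRainbow lab u)
    (hmed : lab (med u) = 0) :
    (∀ e, ∃ i, e ∈ exc u i) ∧ (∀ i e e', e ∈ exc u i → e' ∈ exc u i → e = e') :=
  cover_of_three_disjoint (exc u) (exc_nonempty hlab hu hmed) (fun _ _ hij => exc_disjoint u hij)

/-- (a) The median is strictly below the join in every block. [this work] -/
theorem med_lt_join {lab : Pt n → ℕ} (hlab : IsMono lab) {u : Fin 3 → Pt n} (hu : IsRainbow lab u)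
    (hmed : lab (med u) = 0) (e : Fin 3) : med u e < join u e := by
  obtain ⟨i, hi⟩ := (three_block_structure hlab hu hmed).1 e
  have h := (exc_spec hi).1
  simp only [exc, Finset.mem_filter, Finset.mem_univ, true_and] at hi
  rw [← h]; exact hi

/-- The one-block lift `s + (t − s)·1_e` of the pair `(s,t) = (med u, join u)`. [this work] -/
def lift1 (u : Fin 3 → Pt n) (e : Fin 3) : Pt n := Function.update (med u) e (join u e)

/-- The two-block lift of `(med u, join u)` missing block `e` (= the join lowered to the median in block `e`). [this work] -/
def lift2 (u : Fin 3 → Pt n) (e : Fin 3) : Pt n := Function.update (join u) e (med u e)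

/-- The one-block lift at `e` dominates the point exceeding in block `e`. [this work] -/
theorem le_lift1 {lab : Pt n → ℕ} (hlab : IsMono lab) {u : Fin 3 → Pt n} (hu : IsRainbow lab u)
    (hmed : lab (med u) = 0) {i e : Fin 3} (hi : e ∈ exc u i) : u i ≤ lift1 u e := by
  intro e'
  by_cases h : e' = e
  · subst h
    simp only [lift1, Function.update_self]
    exact le_of_eq (exc_spec hi).1
  · simp only [lift1, Function.update_of_ne h]
    obtain ⟨i', hi'⟩ := (three_block_structure hlab hu hmed).1 e'
    have hne : i' ≠ i := by
      rintro rfl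
      exact h ((three_block_structure hlab hu hmed).2 i' e' e hi' hi)
    exact (exc_spec hi').2 i (Ne.symm hne)

/-- The two-block lift missing `e` dominates every point not exceeding in block `e`. [this work] -/
theorem le_lift2 {u : Fin 3 → Pt n} {i j e : Fin 3} (hi : e ∈ exc u i) (hj : j ≠ i) : u j ≤ lift2 u e := by
  intro e'
  by_cases h : e' = e
  · subst h
    simp only [lift2, Function.update_self]
    exact (exc_spec hi).2 j hj
  · simp only [lift2, Function.update_of_ne h]
    simp only [join]
    fin_cases j <;> simp

/-- (b) A one-block lift is never a bottom point; if it is a petal point it carries the petal of the point exceeding in that block —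
so one-block lifts that are petal points have pairwise distinct petals. [this work] -/
theorem lab_lift1 {lab : Pt n → ℕ} (hlab : IsMono lab) {u : Fin 3 → Pt n} (hu : IsRainbow lab u)
    (hmed : lab (med u) = 0) {i e : Fin 3} (hi : e ∈ exc u i) :
    lab (lift1 u e) = lab (u i) ∨ lab (lift1 u e) = 1 := by
  rcases hlab (le_lift1 hlab hu hmed hi) with h | h | h
  · exact Or.inl h.symm
  · have := hu.1 i; omega
  · exact Or.inr h

/-- (c) Every two-block lift is a kernel point. [this work] -/
theorem lab_lift2 {lab : Pt n → ℕ} (hlab : IsMono lab) {u : Fin 3 → Pt n} (hu : IsRainbow lab u)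
    (hmed : lab (med u) = 0) (e : Fin 3) : lab (lift2 u e) = 1 := by
  obtain ⟨i, hi⟩ := (three_block_structure hlab hu hmed).1 e
  -- the two other points j ≠ i are below the lift and carry distinct petals
  have key : ∀ j, j ≠ i → (lab (lift2 u e) = lab (u j) ∨ lab (lift2 u e) = 1) := by
    intro j hj
    rcases hlab (le_lift2 hi hj) with h | h | h
    · exact Or.inl h.symm
    · have := hu.1 j; omega
    · exact Or.inr h
  obtain ⟨h01, h02, h12⟩ := hu.2
  fin_cases i
  · rcases key 1 (by decide) with h | h
    · rcases key 2 (by decide) with h' | h'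
      · exact absurd (h.symm.trans h') h12
      · exact h'
    · exact h
  · rcases key 0 (by decide) with h | h
    · rcases key 2 (by decide) with h' | h'
      · exact absurd (h.symm.trans h') h02
      · exact h'
    · exact h
  · rcases key 0 (by decide) with h | h
    · rcases key 1 (by decide) with h' | h'
      · exact absurd (h.symm.trans h') h01
      · exact h'
    · exact h

/-- (d) The join of such a rainbow is a kernel point. [this work] -/
theorem lab_join {lab : Pt n → ℕ} (hlab : IsMono lab) {u : Fin 3 → Pt n} (hu : IsRainbow lab u)
    (hmed : lab (med u) = 0) : lab (join u) = 1 := by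
  have hle : lift2 u 0 ≤ join u := by
    intro e'
    by_cases h : e' = 0
    · subst h; simp only [lift2, Function.update_self]; exact le_of_lt (med_lt_join hlab hu hmed 0)
    · simp only [lift2, Function.update_of_ne h]; exact le_rfl
  have h2 := lab_lift2 hlab hu hmed 0
  rcases hlab hle with h | h | h
  · rw [← h]; exact h2
  · omega
  · exact h

end StructureLemma

/-! ## Slot symmetry of orbit sums and the symmetric kernel (any number of blocks) -/

section SlotSymmetry

variable {k : ℕ} {n : Fin k → ℕ}

/-- Diagonal slot permutation of a triple: `(slotPerm σ t) i = t (σ i)`. [this work] -/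
def slotPerm (σ : Equiv.Perm (Fin 3)) (t : Fin 3 → Pt n) : Fin 3 → Pt n := fun i => t (σ i)

/-- A slot permutation after the action of `g` is the action of `g * σ`. [this work] -/
theorem slotPerm_act (σ : Equiv.Perm (Fin 3)) (g : Sym k) (t : Fin 3 → Pt n) :
    slotPerm σ (act g t) = act (g * fun _ => σ) t := by
  funext i e
  simp [slotPerm, act, Equiv.Perm.mul_apply]

/-- **Slot symmetry.**  Orbit sums are invariant under permuting the three slots of the kernel. [this work] -/
theorem orbitSum_slotPerm (κ : (Fin 3 → Pt n) → ℤ) (σ : Equiv.Perm (Fin 3)) (t : Fin 3 → Pt n) :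
    orbitSum (fun s => κ (slotPerm σ s)) t = orbitSum κ t := by
  unfold orbitSum
  simp_rw [slotPerm_act]
  exact Fintype.sum_equiv (Equiv.mulRight (fun _ => σ)) _ _ (fun g => rfl)

/-- Orbit sums are additive in the kernel. [this work] -/
theorem orbitSum_add (κ₁ κ₂ : (Fin 3 → Pt n) → ℤ) (t : Fin 3 → Pt n) :
    orbitSum (fun s => κ₁ s + κ₂ s) t = orbitSum κ₁ t + orbitSum κ₂ t := by
  unfold orbitSum; exact Finset.sum_add_distrib

/-- Orbit sums are homogeneous in the kernel. [this work] -/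
theorem orbitSum_smul (c : ℤ) (κ : (Fin 3 → Pt n) → ℤ) (t : Fin 3 → Pt n) :
    orbitSum (fun s => c * κ s) t = c * orbitSum κ t := by
  unfold orbitSum; rw [Finset.mul_sum]

/-- Orbit sums of a difference. [this work] -/
theorem orbitSum_sub (κ₁ κ₂ : (Fin 3 → Pt n) → ℤ) (t : Fin 3 → Pt n) :
    orbitSum (fun s => κ₁ s - κ₂ s) t = orbitSum κ₁ t - orbitSum κ₂ t := by
  unfold orbitSum; exact Finset.sum_sub_distrib _ _

/-- The SYMMETRIC kernel: the same four terms with unordered petal conditions (`≠` instead of `<`) and the matching multiplicities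
`6, 3, 1, 6`; it depends on the labelling only through the cells `{lab = 0}`, `{lab = 1}` and the partition of the petal points into
petals (not on the numbering of the petals). [this work] -/
def kerSym (p q : ℕ) (lab : Pt n → ℕ) (m : Pt n → Pt n → ℕ) (x y z : Pt n) : ℤ :=
  6 * (if lab x = p ∧ lab y = p ∧ lab z = q then 1 else 0)
    - 3 * (if lab x = p ∧ 2 ≤ lab y ∧ 2 ≤ lab z ∧ lab y ≠ lab z then 1 else 0)
    - (if 2 ≤ lab x ∧ 2 ≤ lab y ∧ 2 ≤ lab z ∧ lab x ≠ lab y ∧ lab x ≠ lab z ∧ lab y ≠ lab z then 1 else 0)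
    - 6 * ((m x y : ℤ) * ((if lab z = p then 1 else 0) - (if lab z = q then 1 else 0)))

/-- The ordered petal-pair indicator symmetrises to the unordered one. [this work] -/
theorem pair_sym (a b c p : ℕ) :
    ((if a = p ∧ 2 ≤ b ∧ 2 ≤ c ∧ b ≠ c then 1 else 0 : ℤ)) =
      (if a = p ∧ 2 ≤ b ∧ b < c then 1 else 0) + (if a = p ∧ 2 ≤ c ∧ c < b then 1 else 0) := by
  split_ifs <;> omega

/-- The increasing petal-triple indicator symmetrises (over the six slot orders) to the pairwise-distinct one. [this work] -/
theorem triple_sym (a b c : ℕ) :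
    ((if 2 ≤ a ∧ 2 ≤ b ∧ 2 ≤ c ∧ a ≠ b ∧ a ≠ c ∧ b ≠ c then 1 else 0 : ℤ)) =
      (if 2 ≤ a ∧ a < b ∧ b < c then 1 else 0) + (if 2 ≤ a ∧ a < c ∧ c < b then 1 else 0)
      + (if 2 ≤ b ∧ b < a ∧ a < c then 1 else 0) + (if 2 ≤ b ∧ b < c ∧ c < a then 1 else 0)
      + (if 2 ≤ c ∧ c < a ∧ a < b then 1 else 0) + (if 2 ≤ c ∧ c < b ∧ b < a then 1 else 0) := by
  split_ifs <;> omega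

/-- **The symmetric kernel has six times the orbit sums of `ker`.**  Hence the local condition can be checked on `kerSym`, which is
blind to the numbering of the petals. [this work] -/
theorem orbitSum_kerSym (p q : ℕ) (lab : Pt n → ℕ) (m : Pt n → Pt n → ℕ) (t : Fin 3 → Pt n) :
    orbitSum (fun s => kerSym p q lab m (s 0) (s 1) (s 2)) t =
      6 * orbitSum (fun s => ker p q lab m (s 0) (s 1) (s 2)) t := by
  -- the four terms of `ker`
  set κ₁ : (Fin 3 → Pt n) → ℤ := fun s => if lab (s 0) = p ∧ lab (s 1) = p ∧ lab (s 2) = q then 1 else 0 with hκ₁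
  set κ₂ : (Fin 3 → Pt n) → ℤ := fun s => if lab (s 0) = p ∧ 2 ≤ lab (s 1) ∧ lab (s 1) < lab (s 2) then 1 else 0 with hκ₂
  set κ₃ : (Fin 3 → Pt n) → ℤ := fun s => if 2 ≤ lab (s 0) ∧ lab (s 0) < lab (s 1) ∧ lab (s 1) < lab (s 2) then 1 else 0
    with hκ₃
  set κ₄ : (Fin 3 → Pt n) → ℤ := fun s => (m (s 0) (s 1) : ℤ) *
      ((if lab (s 2) = p then 1 else 0) - (if lab (s 2) = q then 1 else 0)) with hκ₄
  have hker : (fun s : Fin 3 → Pt n => ker p q lab m (s 0) (s 1) (s 2)) = fun s => κ₁ s - κ₂ s - κ₃ s - κ₄ s := by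
    funext s; simp only [ker, hκ₁, hκ₂, hκ₃, hκ₄]
  -- slot permutations used
  let σ12 : Equiv.Perm (Fin 3) := Equiv.swap 1 2
  let σ01 : Equiv.Perm (Fin 3) := Equiv.swap 0 1
  let σ02 : Equiv.Perm (Fin 3) := Equiv.swap 0 2
  let c012 : Equiv.Perm (Fin 3) := (Equiv.swap 0 1).trans (Equiv.swap 1 2)
  let c021 : Equiv.Perm (Fin 3) := (Equiv.swap 1 2).trans (Equiv.swap 0 1)
  have hsym : (fun s : Fin 3 → Pt n => kerSym p q lab m (s 0) (s 1) (s 2)) = fun s =>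
      6 * κ₁ s - 3 * (κ₂ s + κ₂ (slotPerm σ12 s))
        - (κ₃ s + κ₃ (slotPerm σ12 s) + κ₃ (slotPerm σ01 s) + κ₃ (slotPerm c012 s) + κ₃ (slotPerm c021 s)
            + κ₃ (slotPerm σ02 s))
        - 6 * κ₄ s := by
    funext s
    simp only [kerSym, hκ₁, hκ₂, hκ₃, hκ₄, slotPerm, σ12, σ01, σ02, c012, c021, Equiv.swap_apply_left,
      Equiv.swap_apply_right, Equiv.trans_apply, Equiv.swap_apply_of_ne_of_ne (show (0 : Fin 3) ≠ 1 by decide)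
        (show (0 : Fin 3) ≠ 2 by decide), Equiv.swap_apply_of_ne_of_ne (show (2 : Fin 3) ≠ 0 by decide)
        (show (2 : Fin 3) ≠ 1 by decide), Equiv.swap_apply_of_ne_of_ne (show (1 : Fin 3) ≠ 0 by decide)
        (show (1 : Fin 3) ≠ 2 by decide)]
    rw [pair_sym, triple_sym]
    ring
  rw [hker, hsym]
  simp only [orbitSum_sub, orbitSum_add, orbitSum_smul, orbitSum_slotPerm]
  ring

end SlotSymmetry

end ChainCert

end Summit.CriticalPhenomena.PercolationContinuityZ3.Theorems.SunflowerPartition
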